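import Literature.NumberTheory.EllipticCurves.BSDHeegnerPointsTorsionProofs
import Literature.NumberTheory.EllipticCurves.AtkinLehnerNewSubspaceProofs
import Literature.NumberTheory.EllipticCurves.AtkinLehnerProductProofs
import Literature.NumberTheory.EllipticCurves.ModularParametrizationDegree
import HarnessLib

/-!
# The Atkin–Lehner group `W ≅ (ℤ/2)^{ω(N)}` acting on `Y₀(N)` by points (kernel step (1a) of es's THEOREM L♮ / E-es-173♭;
# cell bsd-f2-manin, prover p2 gen 20; `--supports stmt-BirchSwinnertonDyer-22967`)

Point-level bookkeeping for the canonical Atkin–Lehner matrices `w(Q) ∈ GL₂(ℝ)` (`atkinLehnerW N Q`, `Q ∥ N`) acting on the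
upper half-plane, read on `Y₀(N) = Γ₀(N)\ℍ` (`Y0.mk`):
* `y0mk_atkinLehnerW_smul_congr` (descends), `y0mk_atkinLehnerW_smul_smul` (involution), `y0mk_atkinLehnerW_one` (`w(1)` is trivial);
* `exists_gamma0_atkinLehnerW_mul_atkinLehnerW` — for coprime exact divisors `Q, Q'`: `w(Q)·w(Q') = γ₁·w(QQ')` with `γ₁ ∈ Γ₀(N)`
  (the matrix identity inside the tree's `slash_atkinLehnerW_mul_comm`, exported); hence `y0mk_atkinLehnerW_mul_coprime`;
* for `S ⊆` the prime factors of `N`, `Q_S = ∏_{p ∈ S} p^{v_p(N)}` is an exact divisor (`prodOrdProj_dvd`, `coprime_prodOrdProj`), and the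
  **symmetric-difference law** `y0mk_atkinLehnerW_prodOrdProj_symmDiff`: `w(Q_S)·w(Q_T)·τ ≡ w(Q_{S ∆ T})·τ` on `Y₀(N)` — i.e. `S ↦ w(Q_S)` is an
  action of the elementary abelian `2`-group `(𝒫(primes of N), ∆)` on `Y₀(N)`;
* `φ_atkinLehnerW_prodOrdProj_smul_of_forall` — if the modular parametrisation satisfies `φ(w(Q_p)τ) = φ(τ)` for the prime-power exact divisors,
  then `φ(w(Q_S)τ) = φ(τ)` for every `S`.
HONEST FRAMING: bookkeeping only (Atkin–Lehner 1970 Lemma 8–10 / Knapp 1993 Lemma 9.24 on points); nothing about `deg φ`, C2 or BSD is proved here.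
[cite: Knapp1993, Lemma 9.24] [cite: AtkinLehner1970, Lemmas 8–10 (the W_q normalise Γ₀(m), commute mod Γ₀(m), W_q² ∈ qΓ₀(m))]
-/

set_option autoImplicit false
-- lint-debt: the directory name repeats the summit name (sibling precedent `ManinLocalTwoThreeSqRootWitnessLaw.lean`)
set_option linter.dupNamespace false

noncomputable section

open scoped MatrixGroups ModularForm
open CongruenceSubgroup Matrix.SpecialLinearGroup UpperHalfPlane
open Literature.NumberTheory.EllipticCurves Literature.NumberTheory.EllipticCurves.ModularForms

namespace Summit.BirchSwinnertonDyer.BirchSwinnertonDyer.Theorems.ManinLocalTwoThree.AtkinLehnerOrbit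

variable {N : ℕ} [NeZero N]

/-! ## §1 `Y₀(N)`-classes, `SameOrbit`, and one Atkin–Lehner matrix -/

omit [NeZero N] in
/-- `Y0.mk τ = Y0.mk τ'` iff `τ'` and `τ` lie in one `Γ₀(N)`-orbit. [folklore] -/
theorem y0mk_eq_iff_sameOrbit (τ τ' : ℍ) : Y0.mk N τ = Y0.mk N τ' ↔ SameOrbit N τ' τ := by
  rw [Y0.mk_eq_mk_iff]
  constructor
  · rintro ⟨γ, h⟩
    exact ⟨γ.1, γ.2, h⟩
  · rintro ⟨γ, hγ, h⟩
    exact ⟨⟨γ, hγ⟩, h⟩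

omit [NeZero N] in
/-- `SameOrbit` points have the same class in `Y₀(N)`. [folklore] -/
theorem y0mk_eq_of_sameOrbit {τ τ' : ℍ} (h : SameOrbit N τ τ') : Y0.mk N τ = Y0.mk N τ' :=
  (y0mk_eq_iff_sameOrbit τ τ').mpr h.symm

omit [NeZero N] in
/-- A `Γ₀(N)`-translate has the same class. [folklore] -/
theorem y0mk_gamma_smul {γ : SL(2, ℤ)} (hγ : γ ∈ Gamma0 N) (τ : ℍ) : Y0.mk N (γ • τ) = Y0.mk N τ :=
  (y0mk_eq_of_sameOrbit ⟨γ, hγ, rfl⟩).symm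

omit [NeZero N] in
/-- **`w(Q)` descends to `Y₀(N)`** (`Q ∥ N`). [cite: Knapp1993, Lemma 9.24] -/
theorem y0mk_atkinLehnerW_smul_congr {Q : ℕ} [NeZero Q] (hQN : Q ∣ N) (hc : Nat.Coprime Q (N / Q)) {τ τ' : ℍ}
    (h : Y0.mk N τ = Y0.mk N τ') :
    Y0.mk N (glCast (atkinLehnerW N Q : GL (Fin 2) ℚ) • τ) = Y0.mk N (glCast (atkinLehnerW N Q : GL (Fin 2) ℚ) • τ') :=
  y0mk_eq_of_sameOrbit (((y0mk_eq_iff_sameOrbit τ τ').mp h).symm.atkinLehnerW_smul hQN hc)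

omit [NeZero N] in
/-- **`w(Q)` is an involution of `Y₀(N)`** (`w(Q)² ∈ Q·Γ₀(N)`). [cite: Knapp1993, Lemma 9.24] -/
theorem y0mk_atkinLehnerW_smul_smul {Q : ℕ} [NeZero Q] (hQN : Q ∣ N) (hc : Nat.Coprime Q (N / Q)) (τ : ℍ) :
    Y0.mk N (glCast (atkinLehnerW N Q : GL (Fin 2) ℚ) • (glCast (atkinLehnerW N Q : GL (Fin 2) ℚ) • τ)) = Y0.mk N τ := by
  obtain ⟨γ₀, hγ₀, h⟩ := exists_atkinLehnerW_smul_atkinLehnerW_smul hQN hc (N := N)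
  rw [h τ]
  exact y0mk_gamma_smul hγ₀ τ

omit [NeZero N] in
/-- **`w(1)` acts trivially on `Y₀(N)`**: `w(1) = β(1) ∈ Γ₀(N)` (its lower-left entry is `N`). [folklore] -/
theorem y0mk_atkinLehnerW_one (τ : ℍ) : Y0.mk N (glCast (atkinLehnerW N 1 : GL (Fin 2) ℚ) • τ) = Y0.mk N τ := by
  have hc : Nat.Coprime 1 (N / 1) := Nat.coprime_one_left _
  have hmem : atkinLehnerSL N 1 ∈ Gamma0 N := by
    rw [Gamma0_mem, (atkinLehnerSL_apply_one N 1 hc).1]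
    simp
  have h1 : (tpD 1 : GL (Fin 2) ℝ) • τ = τ := by
    have hval : ((tpD 1 : GL (Fin 2) ℝ) : Matrix (Fin 2) (Fin 2) ℝ) = 1 := by
      rw [val_tpD]
      ext i j
      fin_cases i <;> fin_cases j <;> simp
    have : (tpD 1 : GL (Fin 2) ℝ) = 1 := Units.ext hval
    rw [this, one_smul]
  rw [glCast_atkinLehnerW, mul_smul, h1]
  exact y0mk_gamma_smul hmem τ

/-! ## §2 Two coprime exact divisors: `w(Q)·w(Q') = γ₁·w(QQ')` -/

omit [NeZero N] in
/-- **`w(Q)·w(Q') = γ₁·w(QQ')`** with `γ₁ ∈ Γ₀(N)`, for coprime exact divisors `Q, Q'` of `N = QQ'M` (Atkin–Lehner 1970 Lemma 10; Knapp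
1993, proof of Lemma 9.24 — the matrix identity `e₁` inside the tree's `slash_atkinLehnerW_mul_comm`, exported). [cite: Knapp1993, Lemma 9.24] -/
theorem exists_gamma0_atkinLehnerW_mul_atkinLehnerW [NeZero N] (Q Q' : ℕ) [NeZero Q] [NeZero Q'] {M : ℕ}
    (hM : N = Q * Q' * M) (hc : Nat.Coprime Q (N / Q)) (hc' : Nat.Coprime Q' (N / Q')) :
    ∃ γ₁ ∈ Gamma0 N, glCast (atkinLehnerW N Q : GL (Fin 2) ℚ) * glCast (atkinLehnerW N Q' : GL (Fin 2) ℚ) =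
      mapGL ℝ γ₁ * glCast (atkinLehnerW N (Q * Q') : GL (Fin 2) ℚ) := by
  have hQN : Q ∣ N := ⟨Q' * M, by rw [hM]; ring⟩
  have hQ'N : Q' ∣ N := ⟨Q * M, by rw [hM]; ring⟩
  have hMQ : N / Q = Q' * M := by
    rw [hM, mul_assoc, Nat.mul_div_cancel_left _ (NeZero.pos Q)]
  have hMQ' : N / Q' = Q * M := by
    rw [hM, mul_comm Q Q', mul_assoc, Nat.mul_div_cancel_left _ (NeZero.pos Q')]
  have hcQQ' : Nat.Coprime (Q * Q') (N / (Q * Q')) := by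
    have h1 : N / (Q * Q') = M := by rw [hM, Nat.mul_div_cancel_left _ (NeZero.pos (Q * Q'))]
    rw [h1]
    refine Nat.Coprime.mul_left ?_ ?_
    · exact Nat.Coprime.coprime_dvd_right ⟨Q', by rw [hMQ]; ring⟩ hc
    · exact Nat.Coprime.coprime_dvd_right ⟨Q, by rw [hMQ']; ring⟩ hc'
  have hb := atkinLehnerSL_bezout N Q hc
  have hb' := atkinLehnerSL_bezout N Q' hc'
  rw [hMQ] at hb
  rw [hMQ'] at hb'
  push_cast at hb hb'
  have hval := val_glCast_atkinLehnerW N Q hQN hc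
  have hval' := val_glCast_atkinLehnerW N Q' hQ'N hc'
  have hN : (N : ℝ) = (Q : ℝ) * Q' * M := by exact_mod_cast hM
  obtain ⟨γ₁, hγ₁, h₁⟩ := exists_gamma0_mul_atkinLehnerW_eq N (Q * Q') hM hcQQ'
    ((atkinLehnerSL N Q) 0 0 * (atkinLehnerSL N Q') 0 0 + (atkinLehnerSL N Q) 0 1 * M)
    ((Q : ℤ) * (atkinLehnerSL N Q) 0 0 * (atkinLehnerSL N Q') 0 1 + (atkinLehnerSL N Q) 0 1 * Q')
    ((Q' : ℤ) * (atkinLehnerSL N Q') 0 0 + Q)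
    ((M : ℤ) * (atkinLehnerSL N Q') 0 1 + 1)
    (by push_cast
        linear_combination ((Q' : ℤ) * (atkinLehnerSL N Q') 0 0 - Q * M * (atkinLehnerSL N Q') 0 1) * hb + hb')
  refine ⟨γ₁, hγ₁, Units.ext ?_⟩
  rw [h₁, Matrix.GeneralLinearGroup.coe_mul, hval, hval']
  ext i j
  fin_cases i <;> fin_cases j <;> simp [Matrix.mul_apply, Fin.sum_univ_two, hN] <;> ring

/-- **On `Y₀(N)`: `w(Q)·(w(Q')·τ) ≡ w(QQ')·τ`** for coprime exact divisors. [cite: Knapp1993, Lemma 9.24] -/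
theorem y0mk_atkinLehnerW_mul_coprime (Q Q' : ℕ) [NeZero Q] [NeZero Q'] {M : ℕ} (hM : N = Q * Q' * M)
    (hc : Nat.Coprime Q (N / Q)) (hc' : Nat.Coprime Q' (N / Q')) (τ : ℍ) :
    Y0.mk N (glCast (atkinLehnerW N Q : GL (Fin 2) ℚ) • (glCast (atkinLehnerW N Q' : GL (Fin 2) ℚ) • τ)) =
      Y0.mk N (glCast (atkinLehnerW N (Q * Q') : GL (Fin 2) ℚ) • τ) := by
  obtain ⟨γ₁, hγ₁, h⟩ := exists_gamma0_atkinLehnerW_mul_atkinLehnerW Q Q' hM hc hc'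
  rw [← mul_smul, h, mul_smul]
  exact y0mk_gamma_smul hγ₁ _

omit [NeZero N] in
/-- Transport of `w(Q)` along an equality of divisors (the `NeZero` instance is a proposition). [folklore] -/
theorem atkinLehnerW_congr {Q₁ Q₂ : ℕ} [NeZero Q₁] [NeZero Q₂] (h : Q₁ = Q₂) :
    (glCast (atkinLehnerW N Q₁ : GL (Fin 2) ℚ)) = glCast (atkinLehnerW N Q₂ : GL (Fin 2) ℚ) := by
  subst h
  rfl

/-! ## §3 The exact divisors `Q_S = ∏_{p ∈ S} p^{v_p(N)}` -/

omit [NeZero N] in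
/-- `Q_S > 0`. [folklore] -/
theorem prodOrdProj_pos (S : Finset ℕ) (hS : S ⊆ N.primeFactors) : 0 < ∏ p ∈ S, p ^ N.factorization p :=
  Finset.prod_pos fun _ hp ↦ pow_pos (Nat.prime_of_mem_primeFactors (hS hp)).pos _

/-- `Q_S ∣ N`. [folklore] -/
theorem prodOrdProj_dvd (S : Finset ℕ) (hS : S ⊆ N.primeFactors) : ∏ p ∈ S, p ^ N.factorization p ∣ N :=
  prod_ordProj_dvd N hS

omit [NeZero N] in
/-- `Q_{S ∪ T} = Q_S · Q_T` for disjoint `S, T`. [folklore] -/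
theorem prodOrdProj_union {S T : Finset ℕ} (h : Disjoint S T) :
    ∏ p ∈ S ∪ T, p ^ N.factorization p = (∏ p ∈ S, p ^ N.factorization p) * ∏ p ∈ T, p ^ N.factorization p :=
  Finset.prod_union h

/-- `Q_S · Q_{S'} = N` for the complementary set of primes `S' = primes(N) ∖ S`. [folklore] -/
theorem prodOrdProj_mul_compl (S : Finset ℕ) (hS : S ⊆ N.primeFactors) :
    (∏ p ∈ S, p ^ N.factorization p) * ∏ p ∈ N.primeFactors \ S, p ^ N.factorization p = N := by
  rw [← Finset.prod_union Finset.disjoint_sdiff, Finset.union_sdiff_of_subset hS]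
  exact Nat.prod_factorization_pow_eq_self (NeZero.ne N)

/-- `N / Q_S = Q_{S'}`. [folklore] -/
theorem div_prodOrdProj (S : Finset ℕ) (hS : S ⊆ N.primeFactors) :
    N / ∏ p ∈ S, p ^ N.factorization p = ∏ p ∈ N.primeFactors \ S, p ^ N.factorization p := by
  refine Nat.div_eq_of_eq_mul_left (prodOrdProj_pos S hS) ?_
  rw [mul_comm]
  exact (prodOrdProj_mul_compl S hS).symm

/-- **`Q_S` is an exact divisor**: `gcd(Q_S, N/Q_S) = 1`. [folklore] -/
theorem coprime_prodOrdProj (S : Finset ℕ) (hS : S ⊆ N.primeFactors) :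
    Nat.Coprime (∏ p ∈ S, p ^ N.factorization p) (N / ∏ p ∈ S, p ^ N.factorization p) := by
  rw [div_prodOrdProj S hS]
  refine Nat.Coprime.prod_left fun p hp ↦ Nat.Coprime.prod_right fun q hq ↦ ?_
  have hpq : p ≠ q := fun h ↦ (Finset.mem_sdiff.mp hq).2 (h ▸ hp)
  exact Nat.coprime_pow_primes _ _ (Nat.prime_of_mem_primeFactors (hS hp))
    (Nat.prime_of_mem_primeFactors (Finset.mem_sdiff.mp hq).1) hpq

/-- `N = Q_S · Q_T · (N / Q_{S ∪ T})` for disjoint `S, T ⊆` primes of `N`. [folklore] -/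
theorem eq_prodOrdProj_mul_prodOrdProj_mul {S T : Finset ℕ} (hS : S ⊆ N.primeFactors) (hT : T ⊆ N.primeFactors) (h : Disjoint S T) :
    N = (∏ p ∈ S, p ^ N.factorization p) * (∏ p ∈ T, p ^ N.factorization p) * (N / ∏ p ∈ S ∪ T, p ^ N.factorization p) := by
  rw [← prodOrdProj_union h]
  exact (Nat.mul_div_cancel' (prodOrdProj_dvd _ (Finset.union_subset hS hT))).symm

/-! ## §4 The symmetric-difference law on `Y₀(N)` -/

/-- Disjoint `S, T`: `w(Q_S)·(w(Q_T)·τ) ≡ w(Q_{S ∪ T})·τ` on `Y₀(N)`. [cite: Knapp1993, Lemma 9.24] -/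
theorem y0mk_atkinLehnerW_prodOrdProj_union {S T : Finset ℕ} (hS : S ⊆ N.primeFactors) (hT : T ⊆ N.primeFactors) (h : Disjoint S T)
    [NeZero (∏ p ∈ S, p ^ N.factorization p)] [NeZero (∏ p ∈ T, p ^ N.factorization p)]
    [NeZero (∏ p ∈ S ∪ T, p ^ N.factorization p)] (τ : ℍ) :
    Y0.mk N (glCast (atkinLehnerW N (∏ p ∈ S, p ^ N.factorization p) : GL (Fin 2) ℚ) •
        (glCast (atkinLehnerW N (∏ p ∈ T, p ^ N.factorization p) : GL (Fin 2) ℚ) • τ)) =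
      Y0.mk N (glCast (atkinLehnerW N (∏ p ∈ S ∪ T, p ^ N.factorization p) : GL (Fin 2) ℚ) • τ) := by
  have h1 := y0mk_atkinLehnerW_mul_coprime (N := N) (∏ p ∈ S, p ^ N.factorization p) (∏ p ∈ T, p ^ N.factorization p)
    (eq_prodOrdProj_mul_prodOrdProj_mul hS hT h) (coprime_prodOrdProj S hS) (coprime_prodOrdProj T hT) τ
  rw [h1, atkinLehnerW_congr (prodOrdProj_union h).symm]

/-- **Symmetric-difference law**: for `S, T ⊆` primes of `N`, `w(Q_S)·(w(Q_T)·τ) ≡ w(Q_{S ∆ T})·τ` on `Y₀(N)` — the map `S ↦ w(Q_S)` is an action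
of the elementary abelian `2`-group `(𝒫, ∆)` on `Y₀(N)` (Atkin–Lehner 1970, Lemma 10). [cite: AtkinLehner1970, Lemma 10] [cite: Knapp1993, Lemma 9.24] -/
theorem y0mk_atkinLehnerW_prodOrdProj_symmDiff {S T : Finset ℕ} (hS : S ⊆ N.primeFactors) (hT : T ⊆ N.primeFactors)
    [NeZero (∏ p ∈ S, p ^ N.factorization p)] [NeZero (∏ p ∈ T, p ^ N.factorization p)]
    [NeZero (∏ p ∈ symmDiff S T, p ^ N.factorization p)] (τ : ℍ) :
    Y0.mk N (glCast (atkinLehnerW N (∏ p ∈ S, p ^ N.factorization p) : GL (Fin 2) ℚ) •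
        (glCast (atkinLehnerW N (∏ p ∈ T, p ^ N.factorization p) : GL (Fin 2) ℚ) • τ)) =
      Y0.mk N (glCast (atkinLehnerW N (∏ p ∈ symmDiff S T, p ^ N.factorization p) : GL (Fin 2) ℚ) • τ) := by
  classical
  -- `A = S \ T`, `B = T \ S`, `C = S ∩ T`
  set A := S \ T with hA
  set B := T \ S with hB
  set C := S ∩ T with hC
  have hAS : A ⊆ N.primeFactors := fun p hp ↦ hS (Finset.mem_sdiff.mp hp).1
  have hBT : B ⊆ N.primeFactors := fun p hp ↦ hT (Finset.mem_sdiff.mp hp).1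
  have hCS : C ⊆ N.primeFactors := fun p hp ↦ hS (Finset.mem_inter.mp hp).1
  have hAC : Disjoint A C := by
    rw [hA, hC]; exact Finset.disjoint_left.mpr fun p hp hq ↦ (Finset.mem_sdiff.mp hp).2 (Finset.mem_inter.mp hq).2
  have hCB : Disjoint C B := by
    rw [hB, hC]; exact Finset.disjoint_left.mpr fun p hp hq ↦ (Finset.mem_sdiff.mp hq).2 (Finset.mem_inter.mp hp).1
  have hAB : Disjoint A B := by
    rw [hA, hB]; exact Finset.disjoint_left.mpr fun p hp hq ↦ (Finset.mem_sdiff.mp hq).2 (Finset.mem_sdiff.mp hp).1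
  have hSAC : S = A ∪ C := by rw [hA, hC, Finset.sdiff_union_inter]
  have hTCB : T = C ∪ B := by rw [hB, hC, Finset.inter_comm, Finset.union_comm, Finset.sdiff_union_inter]
  have hΔ : symmDiff S T = A ∪ B := by
    rw [hA, hB]; exact symmDiff_def S T
  haveI : NeZero (∏ p ∈ A, p ^ N.factorization p) := ⟨(prodOrdProj_pos A hAS).ne'⟩
  haveI : NeZero (∏ p ∈ B, p ^ N.factorization p) := ⟨(prodOrdProj_pos B hBT).ne'⟩
  haveI : NeZero (∏ p ∈ C, p ^ N.factorization p) := ⟨(prodOrdProj_pos C hCS).ne'⟩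
  haveI : NeZero (∏ p ∈ A ∪ C, p ^ N.factorization p) := ⟨(prodOrdProj_pos _ (Finset.union_subset hAS hCS)).ne'⟩
  haveI : NeZero (∏ p ∈ C ∪ B, p ^ N.factorization p) := ⟨(prodOrdProj_pos _ (Finset.union_subset hCS hBT)).ne'⟩
  haveI : NeZero (∏ p ∈ A ∪ B, p ^ N.factorization p) := ⟨(prodOrdProj_pos _ (Finset.union_subset hAS hBT)).ne'⟩
  have hcA := coprime_prodOrdProj (N := N) A hAS
  have hcB := coprime_prodOrdProj (N := N) B hBT
  have hcC := coprime_prodOrdProj (N := N) C hCS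
  have hdA := prodOrdProj_dvd (N := N) A hAS
  have hdC := prodOrdProj_dvd (N := N) C hCS
  -- rewrite `S`, `T`, `S ∆ T`
  have eS : (glCast (atkinLehnerW N (∏ p ∈ S, p ^ N.factorization p) : GL (Fin 2) ℚ)) =
      glCast (atkinLehnerW N (∏ p ∈ A ∪ C, p ^ N.factorization p) : GL (Fin 2) ℚ) :=
    atkinLehnerW_congr (by rw [← hSAC])
  have eT : (glCast (atkinLehnerW N (∏ p ∈ T, p ^ N.factorization p) : GL (Fin 2) ℚ)) =
      glCast (atkinLehnerW N (∏ p ∈ C ∪ B, p ^ N.factorization p) : GL (Fin 2) ℚ) :=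
    atkinLehnerW_congr (by rw [← hTCB])
  have eΔ : (glCast (atkinLehnerW N (∏ p ∈ symmDiff S T, p ^ N.factorization p) : GL (Fin 2) ℚ)) =
      glCast (atkinLehnerW N (∏ p ∈ A ∪ B, p ^ N.factorization p) : GL (Fin 2) ℚ) :=
    atkinLehnerW_congr (by rw [hΔ])
  rw [eS, eT, eΔ]
  set wA := glCast (atkinLehnerW N (∏ p ∈ A, p ^ N.factorization p) : GL (Fin 2) ℚ) with hwA
  set wB := glCast (atkinLehnerW N (∏ p ∈ B, p ^ N.factorization p) : GL (Fin 2) ℚ) with hwB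
  set wC := glCast (atkinLehnerW N (∏ p ∈ C, p ^ N.factorization p) : GL (Fin 2) ℚ) with hwC
  -- `w(Q_T)·τ ≡ w_C·(w_B·τ)` and `w(Q_S)·x ≡ w_A·(w_C·x)`
  have hT' : Y0.mk N (glCast (atkinLehnerW N (∏ p ∈ C ∪ B, p ^ N.factorization p) : GL (Fin 2) ℚ) • τ) =
      Y0.mk N (wC • (wB • τ)) := (y0mk_atkinLehnerW_prodOrdProj_union hCS hBT hCB τ).symm
  have hS' : ∀ x : ℍ, Y0.mk N (glCast (atkinLehnerW N (∏ p ∈ A ∪ C, p ^ N.factorization p) : GL (Fin 2) ℚ) • x) =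
      Y0.mk N (wA • (wC • x)) := fun x ↦ (y0mk_atkinLehnerW_prodOrdProj_union hAS hCS hAC x).symm
  have hSAC' : (∏ p ∈ A ∪ C, p ^ N.factorization p) ∣ N := prodOrdProj_dvd _ (Finset.union_subset hAS hCS)
  have hcAC := coprime_prodOrdProj (N := N) (A ∪ C) (Finset.union_subset hAS hCS)
  calc Y0.mk N (glCast (atkinLehnerW N (∏ p ∈ A ∪ C, p ^ N.factorization p) : GL (Fin 2) ℚ) •
          (glCast (atkinLehnerW N (∏ p ∈ C ∪ B, p ^ N.factorization p) : GL (Fin 2) ℚ) • τ))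
      = Y0.mk N (glCast (atkinLehnerW N (∏ p ∈ A ∪ C, p ^ N.factorization p) : GL (Fin 2) ℚ) • (wC • (wB • τ))) :=
        y0mk_atkinLehnerW_smul_congr hSAC' hcAC hT'
    _ = Y0.mk N (wA • (wC • (wC • (wB • τ)))) := hS' _
    _ = Y0.mk N (wA • (wB • τ)) := y0mk_atkinLehnerW_smul_congr hdA hcA (y0mk_atkinLehnerW_smul_smul hdC hcC (wB • τ))
    _ = Y0.mk N (glCast (atkinLehnerW N (∏ p ∈ A ∪ B, p ^ N.factorization p) : GL (Fin 2) ℚ) • τ) :=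
        y0mk_atkinLehnerW_prodOrdProj_union hAS hBT hAB τ

/-! ## §5 `φ`-invariance under `w(Q_S)` from invariance under the prime-power `w(Q_p)` -/

/-- If `φ(w(Q_p)·τ) = φ(τ)` for every prime `p ∈ S` (`Q_p = p^{v_p(N)}`), then `φ(w(Q_S)·τ) = φ(τ)` (`φ` factors through `Y₀(N)`). [folklore] -/
theorem φ_atkinLehnerW_prodOrdProj_smul_of_forall {W : WeierstrassCurve ℚ} (D : ModularParametrizationData W N)
    (S : Finset ℕ) (hS : S ⊆ N.primeFactors) [hQ : NeZero (∏ p ∈ S, p ^ N.factorization p)]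
    (hφ : ∀ p ∈ S, ∀ τ : ℍ, haveI : NeZero (p ^ N.factorization p) := ⟨(Nat.ordProj_pos N p).ne'⟩
      D.φ (glCast (atkinLehnerW N (p ^ N.factorization p) : GL (Fin 2) ℚ) • τ) = D.φ τ) (τ : ℍ) :
    D.φ (glCast (atkinLehnerW N (∏ p ∈ S, p ^ N.factorization p) : GL (Fin 2) ℚ) • τ) = D.φ τ := by
  classical
  induction S using Finset.induction_on generalizing hQ τ with
  | empty =>
    have e1 : (glCast (atkinLehnerW N (∏ p ∈ (∅ : Finset ℕ), p ^ N.factorization p) : GL (Fin 2) ℚ)) =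
        glCast (atkinLehnerW N 1 : GL (Fin 2) ℚ) := atkinLehnerW_congr Finset.prod_empty
    rw [e1]
    exact D.φ_eq_of_mk_eq_mk_holds' (y0mk_atkinLehnerW_one τ)
  | insert p S hpS ih =>
    have hp : p ∈ N.primeFactors := hS (Finset.mem_insert_self p S)
    have hS' : S ⊆ N.primeFactors := fun q hq ↦ hS (Finset.mem_insert_of_mem hq)
    haveI : NeZero (p ^ N.factorization p) := ⟨(Nat.ordProj_pos N p).ne'⟩
    haveI : NeZero (∏ q ∈ S, q ^ N.factorization q) := ⟨(prodOrdProj_pos S hS').ne'⟩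
    haveI : NeZero (∏ q ∈ ({p} : Finset ℕ), q ^ N.factorization q) := by rw [Finset.prod_singleton]; infer_instance
    haveI : NeZero (∏ q ∈ {p} ∪ S, q ^ N.factorization q) := ⟨(prodOrdProj_pos _ (Finset.union_subset (by simpa using hp) hS')).ne'⟩
    have hdisj : Disjoint ({p} : Finset ℕ) S := Finset.disjoint_singleton_left.mpr hpS
    have e1 : (glCast (atkinLehnerW N (∏ q ∈ insert p S, q ^ N.factorization q) : GL (Fin 2) ℚ)) =
        glCast (atkinLehnerW N (∏ q ∈ {p} ∪ S, q ^ N.factorization q) : GL (Fin 2) ℚ) :=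
      atkinLehnerW_congr (by rw [Finset.insert_eq])
    have e2 : (glCast (atkinLehnerW N (∏ q ∈ ({p} : Finset ℕ), q ^ N.factorization q) : GL (Fin 2) ℚ)) =
        glCast (atkinLehnerW N (p ^ N.factorization p) : GL (Fin 2) ℚ) :=
      atkinLehnerW_congr (Finset.prod_singleton _ _)
    rw [e1, D.φ_eq_of_mk_eq_mk_holds' (y0mk_atkinLehnerW_prodOrdProj_union (N := N) (by simpa using hp) hS' hdisj τ).symm, e2,
      hφ p (Finset.mem_insert_self p S), ih hS' (fun q hq ↦ hφ q (Finset.mem_insert_of_mem hq))]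

end Summit.BirchSwinnertonDyer.BirchSwinnertonDyer.Theorems.ManinLocalTwoThree.AtkinLehnerOrbit

end
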